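import Literature.MathematicalPhysics.QuantumFieldTheory.Balaban1983to89.B9Eq315QtorusReadingZdPer
import Literature.MathematicalPhysics.QuantumFieldTheory.Balaban1983to89.B9SupplySockB9P3ZdAllLettersZdPer
import Literature.MathematicalPhysics.QuantumFieldTheory.Balaban1983to89.B9HilbertSchmidtFibreCoordinates
import Literature.MathematicalPhysics.QuantumFieldTheory.Balaban1983to89.B9Thm311FlatPositivityZdPer

/-!
# `Balaban1983to89.B9Thm311FlatCoercivityAllLettersZdPer` — [Balaban1985BackgroundPropagators] THEOREM 3.11 p. 416 AT THE FLAT BACKGROUND FOR THE GENUINE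
# FOUR-LETTER RECORD `opsAllZdPer` ON THE TORUS `T_P` READ ON `ℤᵈ`, WITH AN EXPLICIT CONSTANT: `⟨A, Δ_a(1)A⟩_per` read in three letters (`D*D` square,
# `R` square, `⟨A, Q*aQ(1)A⟩_per`; `Δ′(1) = 0`), the three squares coercive by [Balaban1984PropagatorsI] (1.90) in the junction's `ℤᵈ` letters (fibre
# coordinates eliminated), the composition `s·Σ|Q_k(1)A|² ≤ ⟨A, Q*aQ(1)A⟩_per ⟹ γ(s)·Σ|A|²_τ ≤ ⟨A, Δ_a(1)A⟩_per`, `γ(s) = (1∕((d+1)·Cst d 1))·min(s·L^{2k}∕Lᵏᵈ, 1)`,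
# and — on the all-torus class, by dag-n06-b's transpose identity — the UNCONDITIONAL bound with `s = η·w_k` for every periodic Hermitian `A`

statement-level skeleton of published theorems with citation tags; proofs where landed; nothing here is a claim about the
Yang–Mills mass gap

`[Balaban1985BackgroundPropagators]` ("B9", CMP **99** (1985) 389–434) Thm 3.11 p. 416, (3.26)–(3.27) p. 395 *«Δ_a = Δ + D R D* + Q*aQ»*, (3.10) p. 392,
(3.16) p. 393, (3.20)–(3.22) p. 394; `[Balaban1984PropagatorsI]` ("B5") Prop. 1.1 (1.90) p. 33; `[Balaban1985RegularSpaces]` ("B8") p. 77 *«Ω_j = T_η»*,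
(1.58) p. 86.  PDF held: `paper:balaban1985-cmp99-background-propagators` pp. 392–395, 416 (re-read 2026-08-28 through the tree docstrings of
`B9SupplySockB9P3ZdAllLettersZdPer` ∕ `B9Eq327GreenZdHermPer`).

CITATION HEADER (lean-in-tree rule).  Cell `pub-ymgap` (YM Track A, HUMAN RULINGS D-0062 ∕ D-0149), node N06 = [B9], width seat `pub-ymgap-dag-n06-w3` (g6);
the CAPSTONE of this seat's bridge pub-balaban NE9 chain ⟶ (β′-PERIODIC) road (memo `HOME/pub-ymgap-dag-n06-w3/BRIDGE-NE9-PERIODIC-g6.md`; storeys S1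
`B9Eq315PeriodicReadingZdPer`, S2 `B9Eq321ProjectionTransportZdPer` ∕ `B9Eq319QprimeReadingZdPer` ∕ `B9Eq321RofUReadingZdPer`, S3 `B9Eq315QtorusReadingZdPer`,
S4 `B9HilbertSchmidtFibreCoordinates` ∕ `B9Eq190FlatCoercivityZdPer`).  WHY.  dag-n06-b g22's `B9SupplySockB9P3ZdAllLettersZdPer.regularAtHPer_opsAllZdPer_of_pos`
makes positivity of `⟨A, Δ_a(U₀)A⟩_per` on `E_𝔤^per(P) ∖ 0` the one remaining input of `RegularAtHPer` for the genuine periodic propagator; dag-n06-b g23's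
`B9Thm311FlatPositivityZdPer` (p645632) inhabits it QUALITATIVELY at `U₀ = 1` through this seat's flat kernel form `B9Thm311FlatKernelZdPer`.  THIS FILE is
the QUANTITATIVE twin: at `U₀ = 1` the form dominates `γ·Σ|A|²_τ` with an EXPLICIT `γ`, for EVERY periodic Hermitian `A` (no restriction to `E_𝔤^per`),
given only a lower bound of the averaging letter by the top-level square (§3) — which the letter owner's transpose identity
`B9Thm311FlatPositivityZdPer.bondPairPer_QQZdP_one_eq` supplies with equality on the all-torus class (§4, unconditional); a (3.25)-type continuity road
(dag-n06-w4) perturbs exactly this constant.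

WHAT IS PROVED (kernel, 0 sorry, 0 def).
* §1 ★★ `bondPairPer_deltaAOf_opsAllZdPer_one_eq` (`⟨A, Δ_a(1)A⟩_per = Σ_κΣ_{ν<κ}Σ_{[0,P)ᵈ} Re τ|(D^η_1A)_{νκ}|² +
  Σ_{[0,P)ᵈ} Re τ|R^per(1)D^{η*}_1A|² + ⟨A, Q*aQ(1)A⟩_per` — dag-n06-b's four-term split + `sum_box_pair_Jcur` + `DpZd_one` + `bondPairPer_DRDs_eq_formPer_sq`).
* §2 `re_trace_star_smul_mul_smul`, ★★★ `three_squares_coercive_zd` ([B5] (1.90) for the three squares in `ℤᵈ` letters, NO fibre coordinates in the statement: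
  `γ(s)·Σ_μΣ_{[0,P)ᵈ} Re τ(A*A) ≤ D-square + R-square + s·Σ_κΣ_{y∈[0,n)ᵈ} Re τ|(linCovIter L 1 A k)(y)_κ|²` for every `s > 0`, `P = Lᵏ·n`, `0 < η`, `η·Lᵏ ≤ 1`,
  all-torus class sections — `B9Eq315QtorusReadingZdPer.flat_coercive_periodic_herm_zd` at `c₀ = c₁ = 1`, `a = s·L^{2k}`, `φ` from
  `B9HilbertSchmidtFibreCoordinates.exists_euclidean_coordinates_of_faithful_trace`).
* §3 ★★★ `bondPairPer_deltaAOf_opsAllZdPer_one_ge_of_QQ_ge` (`s·Σ|linCovIter L 1 A k|²_τ ≤ ⟨A, Q*aQ(1)A⟩_per ⟹ γ(s)·Σ|A|²_τ ≤ ⟨A, Δ_a(1)A⟩_per` at the member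
  `(M, i, k)`, `P = Lᵏ·n`, `i.Λs k` the all-torus sections), ★★ `bondPairPer_deltaAOf_opsAllZdPer_one_pos_of_QQ_ge` (`A ≠ 0` on the cell ⟹ `0 < ⟨A, Δ_a(1)A⟩_per`).
* §4 ★★ `bondPairPer_QQZdP_one_torus_eq` (`ΛbP k = torusLamb k`, `P = Lᵏ·n`: `⟨A, Q*aQ(1)A⟩_per = η·w_k·Σ_κΣ_{y∈[0,n)ᵈ} Re τ|(linCovIter L 1 A k)(y)_κ|²` — dag-n06-b's
  `bondPairPer_QQZdP_one_eq` with only `j = k` surviving), ★★★ `bondPairPer_deltaAOf_opsAllZdPer_one_ge` (UNCONDITIONAL: `γ·Σ_μΣ_{[0,P)ᵈ} Re τ(A*A) ≤ ⟨A, Δ_a(1)A⟩_per`,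
  `γ = (1∕((d+1)·Cst d 1))·min(η·w_k·L^{2k}∕Lᵏᵈ, 1)`, every `P`-periodic Hermitian `A`, `i.Λs k = torusLam k`, `η·Lᵏ ≤ 1`, `L ≥ 2`), ★★
  `bondPairPer_deltaAOf_opsAllZdPer_one_pos_of_ne_zero` (`A ≠ 0 ⟹ 0 < ⟨A, Δ_a(1)A⟩_per`, no restriction to `E_𝔤^per(P)`).

HONEST SCOPE.  Count-neutral helper (`--supports` the K1 item of record).  The one estimate is N02's kernel-certified [B5] (1.90), IMPORTED through the NE9
chain and this seat's bridge — explicit constant, no new estimate; flat background `U₀ = 1` only; the averaging letter enters through the HYPOTHESIS `hQ` of §3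
and is discharged in §4 by the letter owner's transpose identity (cited by name, not restated) on the ALL-TORUS class only (general periodised-tower classes:
not here); Thm 3.11 ∕ 3.3 at `U₀ ≠ 1` NOT proved; no member-uniformity beyond the display (the constant depends on `d, L, k, η`, not on `n`);
N05 ∕ N06 NOT discharged; K1 NOT closed; one finite `𝕋⁴` programme at fixed `ε`, Bałaban as printed; R4 closes only the conditional finite-`𝕋⁴` rung
`BalabanLadder.UV` — nothing continuum ∕ ℝ⁴ ∕ OS ∕ mass gap ∕ Clay.  Unit `pub-ymgap-dag-n06-w3` (g6), 2026-08-28; NEW file importing `B9Eq315QtorusReadingZdPer`,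
`B9SupplySockB9P3ZdAllLettersZdPer`, `B9HilbertSchmidtFibreCoordinates`, `B9Thm311FlatPositivityZdPer`; modifies nothing.  Net new unproved facts: 0.
-/

noncomputable section

open scoped BigOperators InnerProductSpace ComplexConjugate

namespace Literature.MathematicalPhysics.QuantumFieldTheory.Balaban1983to89.B9Thm311FlatCoercivityAllLettersZdPer

open B7Eq78Linearization (conjR)
open B7Prop2Explicit (unitaryUnits)
open B7Prop4GeneralLevels (linCovIter)
open B8Eq146AExpansion (plaqCovDeriv)
open B8Eq138LandauZd (covDivB)
open B8Eq155JBound (Jcur)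
open B8LeafModelZd (ZdIdx)
open T4TermwiseTorus (IsPeriodic box tcls tlift tlift_mem_box)
open B9Eq316AveragingTransposeZd (wQ)
open B9SupplySockB9P3ZdLetters (OpsZd deltaAOf)
open B9Eq369CurvSmallZd (DpZd DpZd_one)
open B9Eq316AveragingTransposeZdPrinted (QQZdP withQQP)
open B9Eq321LandauProjectionZdPer (perSub formPer perRestrict perRestrict_eq_self projEPer projRPer isPeriodic_covDivB formPer_apply)
open B9Eq327GreenZdHermPer (bondPairPer bondPairPer_zero_right sum_box_pair_Jcur)
open B9Eq326GaugeTermSquareZd (re_trace_star_pair_invariant)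
open B9SupplySockB9P3ZdAllLettersZdPer (opsAllZdPer opsLandauPer bondPairPer_deltaAOf_opsAllZdPer_eq_four_terms bondPairPer_DRDs_eq_formPer_sq)
open B8Thm4TorusAt (torusLam torusLam_self torusLam_of_ne)
open B8Thm2TorusMember (torusLamb mem_torusLamb_iff)
open B9Thm311FlatPositivityZdPer (bondPairPer_QQZdP_one_eq isPeriodic_mem_torusLamb projRPer_covDivB_eq_coe)

-- `Site` alone could resolve to the torus sites of `Setup.lean`; re-export the `ℤ^d` sites of `B7Prop1Explicit`.
export B7Prop1Explicit (Site)

variable {d : ℕ} {𝔸 : Type*} [CStarAlgebra 𝔸]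

/-! ## §1  `⟨A, Δ_a(1)A⟩_per` read in three letters: the `D*D` square, the `R` square, and `⟨A, Q*aQ(1)A⟩_per` (`Δ′(1) = 0`) -/

section ThreeLetters

variable (τ : 𝔸 →ₗ[ℂ] ℂ) {L : ℕ} (P : ℕ) [FiniteDimensional ℝ 𝔸] [NeZero P]

/-- ★★ **`⟨A, Δ_a(1)A⟩_per` OF THE GENUINE TORUS RECORD, READ IN THREE LETTERS**: at the flat background, for a `P`-periodic bond field `A` and a faithful
Hermitian tracial `τ`,
`⟨A, Δ_a(1)A⟩_per = Σ_κ Σ_{ν<κ} Σ_{[0,P)ᵈ} Re τ|(D^η_1 A)_{νκ}|² + Σ_{[0,P)ᵈ} Re τ|R^per(1) D^{η*}_1 A|² + ⟨A, Q*aQ(1)A⟩_per`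
— the four-term split (dag-n06-b g22), the energy identity `sum_box_pair_Jcur`, `Δ′(1) = 0` (`DpZd_one`), and the `DRD*` square `bondPairPer_DRDs_eq_formPer_sq`.
[cite: Balaban1985BackgroundPropagators, (3.26) p.395, (3.10) p.392, (3.20) p.394, Thm 3.11 p.416] -/
theorem bondPairPer_deltaAOf_opsAllZdPer_one_eq (hτt : ∀ a b : 𝔸, τ (a * b) = τ (b * a))
    (hτs : ∀ a : 𝔸, τ (star a) = starRingEnd ℂ (τ a)) (hτp : ∀ a : 𝔸, a ≠ 0 → 0 < (τ (star a * a)).re)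
    (ΛbP : ℕ → ℕ → Set (Site d × Fin d)) (ops₀ : ℝ → ZdIdx d L → ℕ → OpsZd d 𝔸) (M : ℝ) (i : ZdIdx d L) (m : ℕ)
    {A : Site d → Fin d → 𝔸} (hA : IsPeriodic P A) :
    bondPairPer τ P A (deltaAOf i.η (opsAllZdPer τ L P ΛbP ops₀ M i m) 1 A) =
      (∑ κ : Fin d, ∑ ν ∈ Finset.Iio κ, ∑ x ∈ box (d := d) P,
          (τ (star (plaqCovDeriv i.η (1 : Site d → Fin d → 𝔸ˣ) A ν κ x) * plaqCovDeriv i.η (1 : Site d → Fin d → 𝔸ˣ) A ν κ x)).re) +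
        (∑ x ∈ box (d := d) P,
          (τ (star (projRPer τ P L m i.η (i.Λs m) (1 : Site d → Fin d → 𝔸ˣ) (covDivB i.η (1 : Site d → Fin d → 𝔸ˣ) A) x) *
            projRPer τ P L m i.η (i.Λs m) (1 : Site d → Fin d → 𝔸ˣ) (covDivB i.η (1 : Site d → Fin d → 𝔸ˣ) A) x)).re) +
        bondPairPer τ P A (QQZdP τ L ΛbP i m 1 A) := by
  have hU : IsPeriodic P (1 : Site d → Fin d → 𝔸ˣ) := fun _ _ => rfl
  have hUu : ∀ (x : Site d) (κ : Fin d), (1 : Site d → Fin d → 𝔸ˣ) x κ ∈ unitaryUnits 𝔸 := fun _ _ => one_mem _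
  rw [bondPairPer_deltaAOf_opsAllZdPer_eq_four_terms P τ ΛbP ops₀ M i m 1 A, DpZd_one, bondPairPer_zero_right, add_zero]
  -- the `D*D` square
  let Bτ : 𝔸 →ₗ[ℝ] 𝔸 →ₗ[ℝ] ℝ :=
    LinearMap.mk₂ ℝ (fun a b => (τ (star a * b)).re)
      (fun a₁ a₂ b => by rw [star_add, add_mul, map_add, Complex.add_re])
      (fun c a b => by
        rw [star_smul, star_trivial, smul_mul_assoc, ← Complex.coe_smul, map_smul, smul_eq_mul, smul_eq_mul, Complex.re_ofReal_mul])
      (fun a b₁ b₂ => by rw [mul_add, map_add, Complex.add_re])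
      (fun c a b => by rw [mul_smul_comm, ← Complex.coe_smul, map_smul, smul_eq_mul, smul_eq_mul, Complex.re_ofReal_mul])
  have hB : ∀ u ∈ unitaryUnits 𝔸, ∀ a b : 𝔸, Bτ (conjR u a) b = Bτ a (conjR u⁻¹ b) :=
    fun u hu a b => re_trace_star_pair_invariant τ hτt hu a b
  have hD : (∑ μ : Fin d, ∑ x ∈ box (d := d) P, (τ (star (A x μ) * Jcur i.η (1 : Site d → Fin d → 𝔸ˣ) A μ x)).re) =
      ∑ κ : Fin d, ∑ ν ∈ Finset.Iio κ, ∑ x ∈ box (d := d) P,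
        (τ (star (plaqCovDeriv i.η (1 : Site d → Fin d → 𝔸ˣ) A ν κ x) * plaqCovDeriv i.η (1 : Site d → Fin d → 𝔸ˣ) A ν κ x)).re :=
    sum_box_pair_Jcur Bτ (unitaryUnits 𝔸) P i.η (1 : Site d → Fin d → 𝔸ˣ) hB hUu hU hA
  -- the `R` square
  have hR : bondPairPer τ P A ((opsLandauPer τ P (B9SupplySockB9P3ZdGammaInAkDpZd.withDpZd (withQQP τ L ΛbP ops₀)) M i m).DRDs 1 A) =
      ∑ x ∈ box (d := d) P,
        (τ (star (projRPer τ P L m i.η (i.Λs m) (1 : Site d → Fin d → 𝔸ˣ) (covDivB i.η (1 : Site d → Fin d → 𝔸ˣ) A) x) *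
          projRPer τ P L m i.η (i.Λs m) (1 : Site d → Fin d → 𝔸ˣ) (covDivB i.η (1 : Site d → Fin d → 𝔸ˣ) A) x)).re := by
    rw [bondPairPer_DRDs_eq_formPer_sq P τ hτt hτs hτp _ M i m hUu hU hA, formPer_apply,
      projRPer_covDivB_eq_coe τ P L m i.η (i.Λs m) hU hA]
  rw [hD, hR]

end ThreeLetters

/-! ## §2  The three squares are coercive at the flat background — [B5] (1.90) in the junction's letters, fibre coordinates eliminated -/

section Coercive

variable (τ : 𝔸 →ₗ[ℂ] ℂ) (L : ℕ) [NeZero L] (k n : ℕ) [NeZero n] [Nontrivial 𝔸] [FiniteDimensional ℝ 𝔸] (η : ℝ)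

omit [NeZero L] [NeZero n] [Nontrivial 𝔸] [FiniteDimensional ℝ 𝔸] in
/-- scalars come out of the trace square: `Re τ((c•v)*(c•v)) = ‖c‖²·Re τ(v*v)`. [cite: Balaban1985BackgroundPropagators, (3.17) p.393 (bookkeeping)] -/
theorem re_trace_star_smul_mul_smul (c : ℂ) (v : 𝔸) : (τ (star (c • v) * (c • v))).re = ‖c‖ ^ 2 * (τ (star v * v)).re := by
  rw [star_smul, smul_mul_assoc, mul_smul_comm, smul_smul, map_smul, smul_eq_mul, Complex.star_def, Complex.conj_mul',
    ← Complex.ofReal_pow, Complex.re_ofReal_mul]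

/-- ★★★ **THE THREE SQUARES ARE COERCIVE AT THE FLAT BACKGROUND** — [B5] Prop. 1.1 (1.90) for the genuine four-letter flat form of the junction on `T_P`,
entirely in `ℤᵈ` letters and with NO fibre coordinates in the statement: for a `P`-periodic HERMITIAN bond field `A` (`P = Lᵏ·n`), `0 < η`, `η·Lᵏ ≤ 1`,
a faithful Hermitian tracial `τ` on a finite-dimensional fibre, the all-torus class sections (`Λs k = univ`, `Λs j = ∅` for `j < k`) and every weight `0 < s`,
`γ(s)·Σ_μΣ_{[0,P)ᵈ} Re τ(A*A) ≤ Σ_κΣ_{ν<κ}Σ_{[0,P)ᵈ} Re τ|(D^η_1 A)_{νκ}|² + Σ_{[0,P)ᵈ} Re τ|R^per(1) D^{η*}_1 A|² + s·Σ_κΣ_{y∈[0,n)ᵈ} Re τ|(linCovIter L 1 A k)(y)_κ|²`,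
`γ(s) = (1∕((d+1)·Cst d 1))·min(s·L^{2k}∕(Lᵏ)ᵈ, 1)` — this seat's `B9Eq315QtorusReadingZdPer.flat_coercive_periodic_herm_zd` at the weights `c₀ = c₁ = 1`,
`a = s·L^{2k}`, with the τ-isometric coordinates supplied by `B9HilbertSchmidtFibreCoordinates.exists_euclidean_coordinates_of_faithful_trace`.
[cite: Balaban1984PropagatorsI, Prop. 1.1 (1.90) p.33; Balaban1985BackgroundPropagators, (3.26) p.395, (3.16) p.393, (3.20) p.394, Thm 3.11 p.416] -/
theorem three_squares_coercive_zd (hτs : ∀ b : 𝔸, τ (star b) = starRingEnd ℂ (τ b)) (hτp : ∀ b : 𝔸, b ≠ 0 → 0 < (τ (star b * b)).re)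
    (hτt : ∀ b b' : 𝔸, τ (b * b') = τ (b' * b)) (hL : 1 ≤ L) (hη0 : 0 < η) (hηL : η * (L ^ k : ℕ) ≤ 1) {s : ℝ} (hs : 0 < s)
    (Λs : ℕ → Set (Site d)) (hΛk : Λs k = Set.univ) (hΛlt : ∀ j, j < k → Λs j = ∅)
    {A : Site d → Fin d → 𝔸} (hAper : IsPeriodic (L ^ k * n) A) (hAherm : ∀ w μ, IsSelfAdjoint (A w μ)) :
    (1 / ((d + 1 : ℝ) * B5Prop11Plancherel.Cst d 1)) * min (s * ((L : ℝ) ^ k) ^ 2 / (((L ^ k : ℕ) : ℝ) ^ d)) 1 *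
        (∑ μ : Fin d, ∑ z ∈ box (d := d) (L ^ k * n), (τ (star (A z μ) * A z μ)).re) ≤
      (∑ κ : Fin d, ∑ ν ∈ Finset.Iio κ, ∑ z ∈ box (d := d) (L ^ k * n),
          (τ (star (plaqCovDeriv η (1 : Site d → Fin d → 𝔸ˣ) A ν κ z) * plaqCovDeriv η (1 : Site d → Fin d → 𝔸ˣ) A ν κ z)).re) +
        (∑ z ∈ box (d := d) (L ^ k * n),
          (τ (star (projRPer τ (L ^ k * n) L k η Λs (1 : Site d → Fin d → 𝔸ˣ) (covDivB η (1 : Site d → Fin d → 𝔸ˣ) A) z) *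
            projRPer τ (L ^ k * n) L k η Λs (1 : Site d → Fin d → 𝔸ˣ) (covDivB η (1 : Site d → Fin d → 𝔸ˣ) A) z)).re) +
        s * ∑ κ : Fin d, ∑ y ∈ box (d := d) n,
          (τ (star (linCovIter L (1 : Site d → Fin d → 𝔸ˣ) A k y κ) * linCovIter L (1 : Site d → Fin d → 𝔸ˣ) A k y κ)).re := by
  haveI : Module.Finite ℂ 𝔸 := Module.Finite.of_restrictScalars_finite ℝ ℂ 𝔸
  haveI h1 : Fact ((0 : ℝ) < 1) := ⟨one_pos⟩
  obtain ⟨φ, hφ⟩ := B9HilbertSchmidtFibreCoordinates.exists_euclidean_coordinates_of_faithful_trace τ hτs hτp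
  have hLk0 : ((L : ℝ) ^ k) ≠ 0 := pow_ne_zero _ (by exact_mod_cast (show L ≠ 0 by omega))
  have ha : 0 < s * ((L : ℝ) ^ k) ^ 2 := mul_pos hs (by positivity)
  have h := B9Eq315QtorusReadingZdPer.flat_coercive_periodic_herm_zd L k n τ η (s * ((L : ℝ) ^ k) ^ 2) φ (c₀ := 1) (c₁ := 1)
    hτs hτp hτt hφ hL hη0 hηL ha Λs hΛk hΛlt hAper hAherm
  -- the `Q`-square: `s·L^{2k}·Σ Re τ|L⁻ᵏ v|² = s·Σ Re τ|v|²`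
  have hc : ‖(((L : ℂ) ^ k))⁻¹‖ ^ 2 * ((L : ℝ) ^ k) ^ 2 = 1 := by
    rw [norm_inv, norm_pow, Complex.norm_natCast, ← mul_pow, inv_mul_cancel₀ hLk0, one_pow]
  have hQ : s * ((L : ℝ) ^ k) ^ 2 * (1 * ∑ κ : Fin d, ∑ y ∈ box (d := d) n,
      (τ (star ((((L : ℂ) ^ k))⁻¹ • linCovIter L (1 : Site d → Fin d → 𝔸ˣ) A k y κ) *
        ((((L : ℂ) ^ k))⁻¹ • linCovIter L (1 : Site d → Fin d → 𝔸ˣ) A k y κ))).re) =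
      s * ∑ κ : Fin d, ∑ y ∈ box (d := d) n,
        (τ (star (linCovIter L (1 : Site d → Fin d → 𝔸ˣ) A k y κ) * linCovIter L (1 : Site d → Fin d → 𝔸ˣ) A k y κ)).re := by
    simp only [re_trace_star_smul_mul_smul, ← Finset.mul_sum, one_mul]
    rw [show s * ((L : ℝ) ^ k) ^ 2 * (‖(((L : ℂ) ^ k))⁻¹‖ ^ 2 * ∑ κ : Fin d, ∑ y ∈ box (d := d) n,
        (τ (star (linCovIter L (1 : Site d → Fin d → 𝔸ˣ) A k y κ) * linCovIter L (1 : Site d → Fin d → 𝔸ˣ) A k y κ)).re) =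
        s * (‖(((L : ℂ) ^ k))⁻¹‖ ^ 2 * ((L : ℝ) ^ k) ^ 2) * ∑ κ : Fin d, ∑ y ∈ box (d := d) n,
        (τ (star (linCovIter L (1 : Site d → Fin d → 𝔸ˣ) A k y κ) * linCovIter L (1 : Site d → Fin d → 𝔸ˣ) A k y κ)).re by ring,
      hc, mul_one]
  have hconst : s * ((L : ℝ) ^ k) ^ 2 * 1 / (1 * (((L ^ k : ℕ) : ℝ) ^ d)) = s * ((L : ℝ) ^ k) ^ 2 / (((L ^ k : ℕ) : ℝ) ^ d) := by
    rw [mul_one, one_mul]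
  rw [hQ, hconst, one_mul, one_mul, one_mul] at h
  exact h

end Coercive

/-! ## §3  Composition: any lower bound `s·Σ|Q_k(1)A|² ≤ ⟨A, Q*aQ(1)A⟩_per` on the averaging letter gives the explicit flat constant of the record -/

section Compose

variable (τ : 𝔸 →ₗ[ℂ] ℂ) {L : ℕ} [NeZero L] (k n : ℕ) [NeZero n] [Nontrivial 𝔸] [FiniteDimensional ℝ 𝔸]

/-- ★★★ **THE EXPLICIT FLAT CONSTANT OF `⟨A, Δ_a(1)A⟩_per` FOR THE GENUINE TORUS RECORD, GIVEN THE AVERAGING LETTER's SQUARE**: at the member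
`(M, i, k)` with period `P = Lᵏ·n`, all-torus class sections at level `k` (`i.Λs k k = univ`, `i.Λs k j = ∅` for `j < k`), `0 < η = i.η`, `η·Lᵏ ≤ 1`:
if the `Q*aQ(1)` letter dominates `s·Σ_κΣ_{y∈[0,n)ᵈ} Re τ|(linCovIter L 1 A k)(y)_κ|²` for some `0 < s` (the letter owner's transpose identity
`⟨A, Q*aQ(1)A⟩_per = Σ_j w_j·…` supplies it with equality at `j = k` on the all-torus class), then for every `P`-periodic Hermitian `A`
`γ(s)·Σ_μΣ_{[0,P)ᵈ} Re τ(A*A) ≤ ⟨A, Δ_a(1)A⟩_per`, `γ(s) = (1∕((d+1)·Cst d 1))·min(s·L^{2k}∕(Lᵏ)ᵈ, 1)` — §1 + §2.  In particular `⟨A, Δ_a(1)A⟩_per > 0`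
for `A ≠ 0` with an EXPLICIT constant: the quantitative flat premise of `B9SupplySockB9P3ZdAllLettersZdPer.regularAtHPer_opsAllZdPer_of_pos`.
[cite: Balaban1985BackgroundPropagators, Thm 3.11 p.416, (3.26) p.395, (3.16) p.393; Balaban1984PropagatorsI, Prop. 1.1 (1.90) p.33] -/
theorem bondPairPer_deltaAOf_opsAllZdPer_one_ge_of_QQ_ge (hτs : ∀ b : 𝔸, τ (star b) = starRingEnd ℂ (τ b))
    (hτp : ∀ b : 𝔸, b ≠ 0 → 0 < (τ (star b * b)).re) (hτt : ∀ b b' : 𝔸, τ (b * b') = τ (b' * b)) (hL : 1 ≤ L)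
    (ΛbP : ℕ → ℕ → Set (Site d × Fin d)) (ops₀ : ℝ → ZdIdx d L → ℕ → OpsZd d 𝔸) (M : ℝ) (i : ZdIdx d L)
    (hηL : i.η * (L ^ k : ℕ) ≤ 1) (hΛk : i.Λs k k = Set.univ) (hΛlt : ∀ j, j < k → i.Λs k j = ∅) {s : ℝ} (hs : 0 < s)
    {A : Site d → Fin d → 𝔸} (hAper : IsPeriodic (L ^ k * n) A) (hAherm : ∀ w μ, IsSelfAdjoint (A w μ))
    (hQ : s * ∑ κ : Fin d, ∑ y ∈ box (d := d) n,
        (τ (star (linCovIter L (1 : Site d → Fin d → 𝔸ˣ) A k y κ) * linCovIter L (1 : Site d → Fin d → 𝔸ˣ) A k y κ)).re ≤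
      bondPairPer τ (L ^ k * n) A (QQZdP τ L ΛbP i k 1 A)) :
    (1 / ((d + 1 : ℝ) * B5Prop11Plancherel.Cst d 1)) * min (s * ((L : ℝ) ^ k) ^ 2 / (((L ^ k : ℕ) : ℝ) ^ d)) 1 *
        (∑ μ : Fin d, ∑ z ∈ box (d := d) (L ^ k * n), (τ (star (A z μ) * A z μ)).re) ≤
      bondPairPer τ (L ^ k * n) A (deltaAOf i.η (opsAllZdPer τ L (L ^ k * n) ΛbP ops₀ M i k) 1 A) := by
  rw [bondPairPer_deltaAOf_opsAllZdPer_one_eq τ (L ^ k * n) hτt hτs hτp ΛbP ops₀ M i k hAper]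
  have h2 := three_squares_coercive_zd τ L k n i.η hτs hτp hτt hL i.hη hηL hs (i.Λs k) hΛk hΛlt hAper hAherm
  linarith

/-- ★★ **COROLLARY — STRICT POSITIVITY WITH THE EXPLICIT CONSTANT**: under the same hypotheses, `A ≠ 0` on the period cell ⟹ `0 < ⟨A, Δ_a(1)A⟩_per`.
[cite: Balaban1985BackgroundPropagators, Thm 3.11 p.416, (3.26) p.395] -/
theorem bondPairPer_deltaAOf_opsAllZdPer_one_pos_of_QQ_ge (hτs : ∀ b : 𝔸, τ (star b) = starRingEnd ℂ (τ b))
    (hτp : ∀ b : 𝔸, b ≠ 0 → 0 < (τ (star b * b)).re) (hτt : ∀ b b' : 𝔸, τ (b * b') = τ (b' * b)) (hL : 1 ≤ L)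
    (ΛbP : ℕ → ℕ → Set (Site d × Fin d)) (ops₀ : ℝ → ZdIdx d L → ℕ → OpsZd d 𝔸) (M : ℝ) (i : ZdIdx d L)
    (hηL : i.η * (L ^ k : ℕ) ≤ 1) (hΛk : i.Λs k k = Set.univ) (hΛlt : ∀ j, j < k → i.Λs k j = ∅) {s : ℝ} (hs : 0 < s)
    {A : Site d → Fin d → 𝔸} (hAper : IsPeriodic (L ^ k * n) A) (hAherm : ∀ w μ, IsSelfAdjoint (A w μ))
    (hA0 : ∃ z ∈ box (d := d) (L ^ k * n), ∃ μ : Fin d, A z μ ≠ 0)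
    (hQ : s * ∑ κ : Fin d, ∑ y ∈ box (d := d) n,
        (τ (star (linCovIter L (1 : Site d → Fin d → 𝔸ˣ) A k y κ) * linCovIter L (1 : Site d → Fin d → 𝔸ˣ) A k y κ)).re ≤
      bondPairPer τ (L ^ k * n) A (QQZdP τ L ΛbP i k 1 A)) :
    0 < bondPairPer τ (L ^ k * n) A (deltaAOf i.η (opsAllZdPer τ L (L ^ k * n) ΛbP ops₀ M i k) 1 A) := by
  have h := bondPairPer_deltaAOf_opsAllZdPer_one_ge_of_QQ_ge τ k n hτs hτp hτt hL ΛbP ops₀ M i hηL hΛk hΛlt hs hAper hAherm hQ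
  refine lt_of_lt_of_le (mul_pos (mul_pos ?_ ?_) ?_) h
  · have hC : (1 : ℝ) ≤ B5Prop11Plancherel.Cst d 1 := le_trans (le_max_right _ _) (le_max_right _ _)
    exact div_pos one_pos (mul_pos (by positivity) (lt_of_lt_of_le one_pos hC))
  · exact lt_min (div_pos (mul_pos hs (by positivity)) (by positivity)) one_pos
  · obtain ⟨z, hz, μ, hzμ⟩ := hA0
    have hnn : ∀ μ' : Fin d, ∀ z' ∈ box (d := d) (L ^ k * n), 0 ≤ (τ (star (A z' μ') * A z' μ')).re := fun μ' z' _ => by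
      by_cases h0 : A z' μ' = 0
      · rw [h0, mul_zero, map_zero, Complex.zero_re]
      · exact (hτp _ h0).le
    calc (0 : ℝ) < (τ (star (A z μ) * A z μ)).re := hτp _ hzμ
      _ ≤ ∑ z' ∈ box (d := d) (L ^ k * n), (τ (star (A z' μ) * A z' μ)).re := Finset.single_le_sum (hnn μ) hz
      _ ≤ ∑ μ' : Fin d, ∑ z' ∈ box (d := d) (L ^ k * n), (τ (star (A z' μ') * A z' μ')).re :=
          Finset.single_le_sum (f := fun μ' => ∑ z' ∈ box (d := d) (L ^ k * n), (τ (star (A z' μ') * A z' μ')).re)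
            (fun μ' _ => Finset.sum_nonneg (hnn μ')) (Finset.mem_univ μ)

end Compose

/-! ## §4  The all-torus class: the letter owner's transpose identity discharges `hQ` with equality — the explicit flat constant, unconditionally -/

section Torus

variable (τ : 𝔸 →ₗ[ℂ] ℂ) {L : ℕ} [NeZero L] (k n : ℕ) [NeZero n] [Nontrivial 𝔸] [FiniteDimensional ℝ 𝔸]

open Classical in
/-- ★★ **ON THE ALL-TORUS BOND CLASS THE AVERAGING LETTER IS THE TOP-LEVEL SQUARE**: with `ΛbP k = torusLamb k` (`Λ_j = ∅` for `j ≠ k`, `Λ_k = T`) and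
`P = Lᵏ·n`, dag-n06-b's `B9Thm311FlatPositivityZdPer.bondPairPer_QQZdP_one_eq` collapses to
`⟨A, Q*aQ(1)A⟩_per = η·w_k·Σ_κΣ_{y∈[0,n)ᵈ} Re τ|(linCovIter L 1 A k)(y)_κ|²`. [cite: Balaban1985BackgroundPropagators, (3.16)–(3.17) p.393; Balaban1985RegularSpaces, p.77 («Ω_j = T_η»), (1.58) p.86] -/
theorem bondPairPer_QQZdP_one_torus_eq (hL : 2 ≤ L) (hτp : ∀ b : 𝔸, b ≠ 0 → 0 < (τ (star b * b)).re)
    (hτs : ∀ b : 𝔸, τ (star b) = starRingEnd ℂ (τ b)) {ΛbP : ℕ → ℕ → Set (Site d × Fin d)} (hΛb : ΛbP k = B8Thm2TorusMember.torusLamb k)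
    (i : ZdIdx d L) {A : Site d → Fin d → 𝔸} (hAper : IsPeriodic (L ^ k * n) A) :
    bondPairPer τ (L ^ k * n) A (QQZdP τ L ΛbP i k 1 A) =
      i.η * wQ (d := d) L i.η k * ∑ κ : Fin d, ∑ y ∈ box (d := d) n,
        (τ (star (linCovIter L (1 : Site d → Fin d → 𝔸ˣ) A k y κ) * linCovIter L (1 : Site d → Fin d → 𝔸ˣ) A k y κ)).re := by
  have hdvd : L ^ k ∣ L ^ k * n := dvd_mul_right _ _
  have hΛ : ∀ j, j ≤ k → ∀ κ : Fin d, IsPeriodic (L ^ k * n / L ^ j) (fun z : Site d => (z, κ) ∈ ΛbP k j) := fun j _ κ => by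
    rw [hΛb]; exact B9Thm311FlatPositivityZdPer.isPeriodic_mem_torusLamb _ _ _ _
  rw [B9Thm311FlatPositivityZdPer.bondPairPer_QQZdP_one_eq τ (L ^ k * n) hL hτp hτs ΛbP i hdvd hΛ hAper, mul_assoc]
  congr 1
  rw [Finset.sum_eq_single_of_mem k (Finset.mem_range.mpr (Nat.lt_succ_self k))]
  · have hLk : 0 < L ^ k := pos_of_gt (Nat.one_le_pow k L (le_trans (by norm_num) hL))
    rw [Nat.mul_div_cancel_left n hLk, hΛb]
    congr 1
    refine Finset.sum_congr rfl fun κ _ => Finset.sum_congr rfl fun y _ => ?_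
    rw [if_pos ((B8Thm2TorusMember.mem_torusLamb_iff k k (y, κ)).mpr rfl)]
  · intro j _ hjk
    rw [hΛb]
    have h0 : ∀ (κ : Fin d) (y : Site d), (y, κ) ∉ B8Thm2TorusMember.torusLamb (d := d) k j := fun κ y h =>
      hjk ((B8Thm2TorusMember.mem_torusLamb_iff k j (y, κ)).mp h)
    simp only [h0, if_false, Finset.sum_const_zero, mul_zero]

/-- ★★★ **[B9] THEOREM 3.11 AT THE FLAT BACKGROUND FOR THE GENUINE TORUS RECORD, WITH AN EXPLICIT CONSTANT**: at a member `(M, i, k)` with the all-torus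
classes of [B8] p. 77 (`i.Λs k = torusLam k`, `ΛbP k = torusLamb k`), `P = Lᵏ·n`, `η·Lᵏ ≤ 1` (`η = i.η > 0`), `L ≥ 2`, for a faithful Hermitian tracial `τ`
on a finite-dimensional fibre and EVERY `P`-periodic Hermitian bond field `A`:
`γ·Σ_μΣ_{[0,P)ᵈ} Re τ(A*A) ≤ ⟨A, Δ_a(1)A⟩_per`, `γ = (1∕((d+1)·Cst d 1))·min(η·w_k·L^{2k}∕Lᵏᵈ, 1)` — N02's [B5] (1.90) through this seat's bridge (§2), the
three-letter reading (§1) and dag-n06-b's transpose identity (§4).  The QUANTITATIVE twin of dag-n06-b's `bondPairPer_deltaAOf_opsAllZdPer_one_pos`.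
[cite: Balaban1985BackgroundPropagators, Thm 3.11 p.416, (3.26) p.395, (3.16) p.393, (3.20) p.394; Balaban1984PropagatorsI, Prop. 1.1 (1.90) p.33; Balaban1985RegularSpaces, p.77 («Ω_j = T_η»)] -/
theorem bondPairPer_deltaAOf_opsAllZdPer_one_ge (hτs : ∀ b : 𝔸, τ (star b) = starRingEnd ℂ (τ b))
    (hτp : ∀ b : 𝔸, b ≠ 0 → 0 < (τ (star b * b)).re) (hτt : ∀ b b' : 𝔸, τ (b * b') = τ (b' * b)) (hL : 2 ≤ L)
    {ΛbP : ℕ → ℕ → Set (Site d × Fin d)} (hΛb : ΛbP k = B8Thm2TorusMember.torusLamb k) (ops₀ : ℝ → ZdIdx d L → ℕ → OpsZd d 𝔸) (M : ℝ)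
    (i : ZdIdx d L) (hηL : i.η * (L ^ k : ℕ) ≤ 1) (hΛs : i.Λs k = B8Thm4TorusAt.torusLam k)
    {A : Site d → Fin d → 𝔸} (hAper : IsPeriodic (L ^ k * n) A) (hAherm : ∀ w μ, IsSelfAdjoint (A w μ)) :
    (1 / ((d + 1 : ℝ) * B5Prop11Plancherel.Cst d 1)) * min (i.η * wQ (d := d) L i.η k * ((L : ℝ) ^ k) ^ 2 / (((L ^ k : ℕ) : ℝ) ^ d)) 1 *
        (∑ μ : Fin d, ∑ z ∈ box (d := d) (L ^ k * n), (τ (star (A z μ) * A z μ)).re) ≤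
      bondPairPer τ (L ^ k * n) A (deltaAOf i.η (opsAllZdPer τ L (L ^ k * n) ΛbP ops₀ M i k) 1 A) := by
  have hL1 : 1 ≤ L := le_trans (by norm_num) hL
  have hs : 0 < i.η * wQ (d := d) L i.η k := mul_pos i.hη (B9Thm311FlatHermKernelZd.wQ_pos hL1 i.hη k)
  have hΛk : i.Λs k k = Set.univ := by rw [hΛs, B8Thm4TorusAt.torusLam_self]
  have hΛlt : ∀ j, j < k → i.Λs k j = ∅ := fun j hj => by rw [hΛs, B8Thm4TorusAt.torusLam_of_ne (ne_of_lt hj)]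
  exact bondPairPer_deltaAOf_opsAllZdPer_one_ge_of_QQ_ge τ k n hτs hτp hτt hL1 ΛbP ops₀ M i hηL hΛk hΛlt hs hAper hAherm
    (le_of_eq (bondPairPer_QQZdP_one_torus_eq τ k n hL hτp hτs hΛb i hAper).symm)

/-- ★★ **COROLLARY — STRICT POSITIVITY FOR EVERY NON-ZERO PERIODIC HERMITIAN `A`** (no restriction to `E_𝔤^per(P)`): under the hypotheses of
`bondPairPer_deltaAOf_opsAllZdPer_one_ge`, `A ≠ 0 ⟹ 0 < ⟨A, Δ_a(1)A⟩_per`. [cite: Balaban1985BackgroundPropagators, Thm 3.11 p.416, (3.26) p.395] -/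
theorem bondPairPer_deltaAOf_opsAllZdPer_one_pos_of_ne_zero (hτs : ∀ b : 𝔸, τ (star b) = starRingEnd ℂ (τ b))
    (hτp : ∀ b : 𝔸, b ≠ 0 → 0 < (τ (star b * b)).re) (hτt : ∀ b b' : 𝔸, τ (b * b') = τ (b' * b)) (hL : 2 ≤ L)
    {ΛbP : ℕ → ℕ → Set (Site d × Fin d)} (hΛb : ΛbP k = B8Thm2TorusMember.torusLamb k) (ops₀ : ℝ → ZdIdx d L → ℕ → OpsZd d 𝔸) (M : ℝ)
    (i : ZdIdx d L) (hηL : i.η * (L ^ k : ℕ) ≤ 1) (hΛs : i.Λs k = B8Thm4TorusAt.torusLam k)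
    {A : Site d → Fin d → 𝔸} (hAper : IsPeriodic (L ^ k * n) A) (hAherm : ∀ w μ, IsSelfAdjoint (A w μ)) (hA0 : A ≠ 0) :
    0 < bondPairPer τ (L ^ k * n) A (deltaAOf i.η (opsAllZdPer τ L (L ^ k * n) ΛbP ops₀ M i k) 1 A) := by
  have hL1 : 1 ≤ L := le_trans (by norm_num) hL
  have hs : 0 < i.η * wQ (d := d) L i.η k := mul_pos i.hη (B9Thm311FlatHermKernelZd.wQ_pos hL1 i.hη k)
  have hΛk : i.Λs k k = Set.univ := by rw [hΛs, B8Thm4TorusAt.torusLam_self]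
  have hΛlt : ∀ j, j < k → i.Λs k j = ∅ := fun j hj => by rw [hΛs, B8Thm4TorusAt.torusLam_of_ne (ne_of_lt hj)]
  -- a non-zero periodic field is non-zero somewhere in the period cell
  have hA0' : ∃ z ∈ box (d := d) (L ^ k * n), ∃ μ : Fin d, A z μ ≠ 0 := by
    by_contra hcon
    apply hA0
    funext x μ
    have hx : A (tlift (tcls (L ^ k * n) x)) μ = 0 := by
      by_contra h1
      exact hcon ⟨_, tlift_mem_box _, μ, h1⟩
    rw [show A (tlift (tcls (L ^ k * n) x)) = A x from hAper.apply_tlift x] at hx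
    exact hx
  exact bondPairPer_deltaAOf_opsAllZdPer_one_pos_of_QQ_ge τ k n hτs hτp hτt hL1 ΛbP ops₀ M i hηL hΛk hΛlt hs hAper hAherm hA0'
    (le_of_eq (bondPairPer_QQZdP_one_torus_eq τ k n hL hτp hτs hΛb i hAper).symm)

end Torus

end Literature.MathematicalPhysics.QuantumFieldTheory.Balaban1983to89.B9Thm311FlatCoercivityAllLettersZdPer

end
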